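import Summits.QuantumFields.BalabanUV.T4Continuum.Spine.NE1p.DressedRootStrict
import Summits.QuantumFields.BalabanUV.T4Continuum.Spine.NE1p.DressedStabilityOfCanonicalSliceWinSchedules

/-!
# T⁴ programme, spine estimate NE1′ (node O3b/H2) — THE ROOT OF RECORD `DressedStabilityStrict` AT THE CANONICAL TERMINAL FACE, part 1
# of 2 (REDUCTION): the face-agnostic bridge from a displayed-constants END-ALL face to the owner's repaired ROOT-C, and the canonical
# terminal face (row S3l) concluding `DressedStabilityStrict 𝒯 (L ^ 4)` BY NAME (swarm item S3s «ROOT-C of record at the canonical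
# terminal face» of `t4/formal/NE1p/LEAVES.md` v2.6.9, node N23s; typer R-T65 (vii); INTENT CLAIMS.log l.12241, CLAIM l.12331)

Cell `pub-balaban`, sub-cell `t4`, BINDER-OWNERS row NE1′, formalisation crew `b2b-balaban-t4-ne1p-formalise-*`, seat `…-leaf-08`
(gen 2; lineage rows T-courier∕R-b∕R-a′∕S2e–S2h∕S8.1).  ADDITIVE — imports the OWNER's `Spine/NE1p/DressedRootStrict` (t4-ne1p-p1
gen 23, p216910 ACCEPTED 781ce3cf2039: ROOT-C OF RECORD `DressedRoot.DressedStabilityStrict`, `dressedStabilityStrict_of_with`,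
`dressedStabilityStrict_of_bookingLeaves`, `dressedBudget_of_dressedStabilityStrict`, `dressedStability_of_strict`; through it ROOT-B
`DressedRootFam.DressedBudget` p211697) and leaf-09's row S3l `Spine/NE1p/DressedStabilityOfCanonicalSliceWinSchedules` (p215128
ACCEPTED 853aaf236d16 — THE CANONICAL TERMINAL FACE; through it row S3's `Spine/NE1p/DressedUniformConstants` p212599:
`uniformConstantsCell`, `prod_cell`, `locCell`, `rhoOne`, `dressedStability_of_cell`) ONLY; modifies nothing (no append to S3l or to any
S3-family file).  Part 2 = `Spine/NE1p/DressedTerminalWitnessStrict.lean` (WITNESS side: the decided toys meet the strict root BY NAME).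

WHY.  The owner's disposition of GAPS `G-wardbootg6-1` (CLAIMS.log l.12196 (B), `DressedRootStrict.lean`): ROOT-C OF RECORD is the
class WITH THE STRICT PRODUCT against the bookings' positional rate,
`DressedStabilityStrict 𝒯 Λ := ∃ A₀ ρ₁ τ r, DressedStabilityWith 𝒯 A₀ ρ₁ τ ∧ 0 ≤ Λ ∧ Λ·ρ₁·τ ≤ r ∧ r < 1`; the product-free
`DressedStability 𝒯` stays a headline ABBREVIATION — necessary, NOT sufficient (`dressedStability_not_imp_dressedBudget`).  Every
END-ALL face the crew landed (S3e∕S3g∕S3h∕S3i∕S3j∕S3k∕S3k.1∕S3l∕S3l.1∕S3m) concludes `DressedStability 𝒯`, the With-form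
`DressedStabilityWith 𝒯 A₀ (rhoOne (L^2)⁻¹ (4c_δ∕r) c̄ κ) (L⁻¹^3)` and ROOT-B — none concludes the root of record BY NAME.  Nothing
is missing mathematically: the strict product of the displayed constants IS (w7)'s located largeness, `L⁴·rhoOne (L^2)⁻¹ C c̄ κ·L⁻³
= locCell L C c̄ κ ≤ ρ′ < 1` (row S3's `prod_cell` and the displayed binders `hloc`∕`hρ′1`), at the positional count constant
`Λ = L⁴` of `uniformConstantsCell`.  This file writes the one-line feed ONCE, face-agnostically, and applies it where the referee's
node test reads the root: at the canonical terminal face.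
* §1 **`dressedStabilityStrict_of_cellWith`** [bookkeeping]: `1 ≤ L`, `locCell L C c̄ κ ≤ ρ′`, `ρ′ < 1` and ANY With-form
  `DressedStabilityWith 𝒯 A₀ (rhoOne (L^2)⁻¹ C c̄ κ) (L⁻¹^3)` ⟹ `DressedStabilityStrict 𝒯 (L^4)` — ONE application serves every
  With-form face of the crew (their constants are literally of this shape; `hL`∕`hloc`∕`hρ′1` are already displayed; NO new binder);
  **`dressedStabilityStrict_of_cell`**: row S3's END-B-over-the-cell door (`dressedStability_of_cell`) in the strict form, by
  `dressedStabilityStrict_of_bookingLeaves (uniformConstantsCell …)` (`Λ = L⁴` definitionally); `dressedBudget_of_cellWith`: the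
  With-form face ⟹ ROOT-B through the root of record (`dressedBudget_of_dressedStabilityStrict`), for the record that the two roots
  of record are reached from the SAME displayed data.
* §2 row S3l's tower-level telescope VERBATIM (section variables, statements header-identical to S3l §2∕§3) and
  **`dressedStabilityStrict_of_canonicalSliceWinSchedules : DressedStabilityStrict 𝒯 (L ^ 4)`** — THE CANONICAL TERMINAL FACE
  CONCLUDES THE ROOT OF RECORD BY NAME: S3l's `dressedStabilityWith_of_canonicalSliceWinSchedules` ∘ §1, same displayed list, nothing
  added, nothing removed.
* §3 is part 2 (`DressedTerminalWitnessStrict`): the function-level witnesses meet the STRICT root BY NAME (W7's `towerM` through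
  END-B at `Λ = UW.Λ = LW⁴`; W11r's integer firing at `Λ = Lb⁴`, `81 ≤ Lb ≤ 120`; the decided `Lb = 100`).

WHAT IT IS NOT.  Not an estimate and not a new face: kernel composition over the owner's repaired root ([folklore]; theorems only,
0 `def`, 0 `def … : Prop`, 0 sorry, 0 citations used as facts).  The WALL is untouched and DISPLAYED exactly as at S3l: (w1) `hsl`;
(w2-act) `hB`∕`hE`∕`hs₀` (printed TYPE [Balaban1989LargeFieldII] (1.65) p. 375, (1.71)–(1.75) pp. 379–380 — CONTEXT only; THE NUMBER
`s̄⁰` a binder); (w5) `hreg`∕`hc0`∕`hcb`; (I4′) `hδf`∕`hδfwk`∕`hpairx`∕`hdefwk`∕`hrate` + `hcm` (F-6's rate `ψ = L⁻²` load-bearing,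
k3); the F-2∕H2 dictionary; F-9 context; anchoring ∕ absorption ∕ booking-convention DATA; located scalars ONCE before `∀ a K` (k1∕k2:
`L` carries the binder `1 ≤ L` and the located `hloc` — no numeral from print).

HONEST FRAMING.  Headline (c4): «the canonical terminal face ⟹ ROOT-C OF RECORD `DressedStabilityStrict 𝒯 L⁴` from EXACTLY its
displayed binders — the strict product is (w7)'s located largeness; NE1′ ⇐ the named binders, NOT proved, NOT printed; 0 binders
instantiated on Bałaban's densities»; spine PROVED 0∕9.  Rung (B)+1 on ONE finite four-torus of fixed physical size — NOT infinite
volume, NOT a mass gap, NOT OS on ℝ⁴, NOT the Clay problem.  HONEST DEPENDENCY: continuum YM on T⁴ ⇐ BetaPertH ∧ nine spine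
estimates (0/9 proved); BetaPertH ⇐ (D1) ∧ (D4) ∧ CAP+tail; G-an2-4 gates asym, D1 and NE2/3/4.
-/

noncomputable section

namespace Summit.QuantumFields.BalabanUV.T4Continuum.NE1p.DressedStabilityStrictOfCanonicalSliceWinSchedules

open MeasureTheory Set Metric Finset
open scoped BigOperators
open Literature.MathematicalPhysics.QuantumFieldTheory.Balaban1983to89
open Literature.MathematicalPhysics.QuantumFieldTheory.Balaban1983to89.T4TermFormat
open Literature.MathematicalPhysics.QuantumFieldTheory.Balaban1983to89.T4FeltGeometry
open Literature.MathematicalPhysics.QuantumFieldTheory.Balaban1983to89.T4GatedBooking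
open Literature.MathematicalPhysics.QuantumFieldTheory.Balaban1983to89.T4TrajectoryComparison
open Literature.MathematicalPhysics.QuantumFieldTheory.Balaban1983to89.T4TrajectoryModulus
open T4BirthChartTransport (GaugeInvariant BirthSlice RelGauge)
open T4BlockTransport (Fld NDir latMove latN)
open T4TrajectoryDensity
open Summit.QuantumFields.BalabanUV.T4Continuum.T4TrajectoryDensityDressed
open Summit.QuantumFields.BalabanUV.T4Continuum.NE1p.DressedRoot
open Summit.QuantumFields.BalabanUV.T4Continuum.NE1p.DressedWindowScheduleWin
open Summit.QuantumFields.BalabanUV.T4Continuum.NE1p.DressedWindowScheduleModWin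
open Summit.QuantumFields.BalabanUV.T4Continuum.NE1p.DressedUniformConstants
open Summit.QuantumFields.BalabanUV.T4Continuum.NE1p.DressedTransportAssembledModData
open Summit.QuantumFields.BalabanUV.T4Continuum.NE1p.DressedStabilityOfCanonicalSliceWinSchedules
open Summit.QuantumFields.BalabanUV.T4Continuum.NE1p.DressedAbsorptionWindow

/-! ## §1 The face-agnostic bridge: a displayed-constants face over the cell's numbers ⟹ the root of record -/

/-- **A WITH-FORM FACE OVER THE CELL's CONSTANTS FEEDS THE ROOT OF RECORD** [bookkeeping]: for `1 ≤ L`, the located largeness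
`locCell L C c̄ κ ≤ ρ′ < 1` ((w7), displayed) and ANY `DressedStabilityWith 𝒯 A₀ (rhoOne (L^2)⁻¹ C c̄ κ) (L⁻¹^3)` (the shape of the
constants displayed by EVERY END-ALL face of the crew), the root of record `DressedStabilityStrict 𝒯 (L^4)` holds — the strict
product `L⁴·rhoOne·L⁻³` IS `locCell` (row S3's `prod_cell`), `Λ = L⁴` the positional count constant of `uniformConstantsCell`.  One
application per face; no binder added. [folklore] -/
theorem dressedStabilityStrict_of_cellWith {P : Type*} {𝒯 : DressedTower P} {A₀ L C cbar κ ρ' : ℝ} (hL : 1 ≤ L)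
    (hloc : locCell L C cbar κ ≤ ρ') (hρ'1 : ρ' < 1)
    (hW : DressedStabilityWith 𝒯 A₀ (rhoOne (L ^ 2)⁻¹ C cbar κ) (L⁻¹ ^ 3)) : DressedStabilityStrict 𝒯 (L ^ 4) :=
  dressedStabilityStrict_of_with hW (pow_nonneg (by linarith) 4) (by rw [prod_cell (by linarith)]; exact hloc) hρ'1

/-- **ROW S3's END-B-OVER-THE-CELL DOOR IN THE STRICT FORM** [bookkeeping]: one set of displayed numbers with (w7)'s located largeness
and (w6)'s window, and at EVERY run parameter and cutoff the per-cutoff leaves for `uniformConstantsCell …` ⟹ the root of record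
`DressedStabilityStrict 𝒯 (L^4)` — `dressedStabilityStrict_of_bookingLeaves` BY NAME (`(uniformConstantsCell …).Λ = L⁴` by `rfl`).
Strict twin of `dressedStability_of_cell`. [folklore] -/
theorem dressedStabilityStrict_of_cell {P : Type*} (𝒯 : DressedTower P) {L C cbar κ N₀ A₀ m sbar ρ' : ℝ} (hL : 1 ≤ L)
    (hC : 0 ≤ C) (hcbar : 0 ≤ cbar) (hκ : 0 ≤ κ) (hN₀ : 0 ≤ N₀) (hA₀ : 0 ≤ A₀) (hm : 0 ≤ m)
    (hloc : locCell L C cbar κ ≤ ρ') (hρ'1 : ρ' < 1) (hsmall : m * (N₀ * A₀ * (1 - ρ')⁻¹) ≤ 1 - sbar)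
    (leaves : ∀ p K, BookingLeaves
      (uniformConstantsCell L C cbar κ N₀ A₀ m sbar ρ' hL hC hcbar hκ hN₀ hA₀ hm hloc hρ'1 hsmall) (𝒯.B p K) (𝒯.T p K)) :
    DressedStabilityStrict 𝒯 (L ^ 4) :=
  dressedStabilityStrict_of_bookingLeaves _ 𝒯 leaves

/-- **THE WITH-FORM FACE ⟹ ROOT-B THROUGH THE ROOT OF RECORD** [bookkeeping]: the same displayed data plus K-free positional counts
at rate `Λ = L⁴` and run weights bounded by one `w̄ ≥ 0` give `DressedBudget 𝒯 w` — `dressedBudget_of_dressedStabilityStrict` ∘ §1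
(for the record: both roots of record from ONE displayed list). [folklore] -/
theorem dressedBudget_of_cellWith {P : Type*} {𝒯 : DressedTower P} {A₀ L C cbar κ ρ' N₀ wbar : ℝ} {w : P → ℕ → ℕ → ℝ}
    (hL : 1 ≤ L) (hloc : locCell L C cbar κ ≤ ρ') (hρ'1 : ρ' < 1)
    (hW : DressedStabilityWith 𝒯 A₀ (rhoOne (L ^ 2)⁻¹ C cbar κ) (L⁻¹ ^ 3)) (hN₀ : 0 ≤ N₀) (hwbar : 0 ≤ wbar)
    (hw0 : ∀ p K, ∀ j ≤ K, 0 ≤ w p K j) (hwb : ∀ p K, ∀ j ≤ K, w p K j ≤ wbar)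
    (hcount : ∀ p K, (𝒯.B p K).PositionalCount fun j k => N₀ * (L ^ 4) ^ (k - j)) : DressedBudget 𝒯 w :=
  dressedBudget_of_dressedStabilityStrict (dressedStabilityStrict_of_cellWith hL hloc hρ'1 hW) hN₀ hwbar hw0 hwb hcount

/-! ## §2 The canonical terminal face concludes the root of record — S3l's telescope verbatim -/

section EndAll

variable {P : Type*} (𝒯 : DressedTower P)
variable {R : Type*} [NormedRing R] [NormedAlgebra ℂ R] [MeasurableSpace R] {d : ℕ}
variable {κ L cbar N₀ A₀ sbar ρ' r cδ m : ℝ} {w : P → ℕ → ℝ}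
variable (W : ∀ (a : P) (K : ℕ), WindowScheduleModWin r (w a K)) (hκ : 0 ≤ κ)
variable {Fn : ∀ (a : P) (K : ℕ), (𝒯.B a K).Birth → ℕ → ℕ → Fld d R → ℂ}
  {rel : ∀ (a : P) (K : ℕ), (𝒯.B a K).Birth → ℕ → ℕ → Fld d R → Fld d R → Prop}
  {ref : ∀ (a : P) (K : ℕ), (𝒯.B a K).Birth → ℕ → Fld d R → Fld d R}
  {base : ∀ (a : P) (K : ℕ), (𝒯.B a K).Birth → ℕ → Fld d R → ℝ}
  {𝒜 𝒬 : ∀ (a : P) (K : ℕ), (𝒯.B a K).Birth → ℕ → Fld d R → Fld d R → ℂ}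
  {q : ∀ (a : P) (K : ℕ), (𝒯.B a K).Birth → ℕ → Fld d R → ℂ}
  {μ : ∀ (a : P) (K : ℕ), (𝒯.B a K).Birth → ℕ → Measure (Fld d R)}
  {z₀ z₁ : ∀ (a : P) (K : ℕ), (𝒯.B a K).Birth → ℕ → Fld d R}
  {defect : ∀ (a : P) (K : ℕ), (𝒯.B a K).Birth → ℕ → ℕ → ℝ}
  {s : ∀ (a : P) (K : ℕ), (𝒯.B a K).Birth → ℕ → ℝ}
  {S : ∀ (a : P) (K : ℕ), ℕ → (𝒯.B a K).Birth → Finset (𝒯.B a K).Birth}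
  {Sg : ∀ (a : P) (K : ℕ), ℕ → (𝒯.B a K).Birth → Finset ((𝒯.B a K).Birth × ℕ)}
  {c : ∀ (a : P) (K : ℕ), (𝒯.B a K).Birth → ℕ → ℂ}
  {δf : ∀ (a : P) (K : ℕ), (𝒯.B a K).Birth → ℕ → (𝒯.B a K).Birth × ℕ → ℝ}
  {creg : ∀ (_ : P) (_ : ℕ), ℕ → ℝ}
-- DATA replacing the structural leaves: anchoring (L-C), absorption (L-B)
variable {Lb mB v : ℕ} (Anch : ∀ (a : P) (K : ℕ), Anchoring (𝒯.B a K) 4 Lb)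
  {comp : ∀ (a : P) (K : ℕ), ℕ → (𝒯.B a K).Birth → Finset (𝒯.B a K).Cube}
  {Sabs : ∀ (a : P) (K : ℕ), (𝒯.B a K).Birth → Finset (𝒯.B a K).Birth}
  {β : ∀ (_ : P) (_ : ℕ), ℕ → ℝ} {A β₀ : ℝ}

-- the ratio family (K-free κ)
variable (hratio : ∀ (a : P) (K : ℕ), ∀ k, 2 * (W a K).σ k ≤ κ * (W a K).ϱc k)
-- row S3's located scalars ((w7) largeness, (w6) window) and signs — ONCE
variable (hL : 1 ≤ L)
variable (hcbar : 0 ≤ cbar)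
variable (hN₀ : 0 ≤ N₀)
variable (hA₀ : 0 ≤ A₀)
variable (hm : 0 ≤ m)
variable (hloc : locCell L (4 * cδ / r) cbar κ ≤ ρ')
variable (hρ'1 : ρ' < 1)
variable (hsmall : m * (N₀ * A₀ * (1 - ρ')⁻¹) ≤ 1 - sbar)
variable (hr : 0 < r)
variable (hcδ : 0 ≤ cδ)
-- the assembled END's estimate families (S3k verbatim)
variable (hsl : ∀ (a : P) (K : ℕ), ∀ (b : (𝒯.B a K).Birth) (k' : ℕ), (𝒯.B a K).birthScale b ≤ k' → k' ≤ (𝒯.B a K).K →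
  RanBelow (budgetGate (𝒯.T a K) (s a K) m (S a K) (4 * cδ / r) (fun i => (L ^ 2)⁻¹ * (fun _ : ℕ => alphaCell κ) i)) k' →
  BirthSlice ((Fn a K) b k' k') latMove latN (bondBall d ((W a K).ρw k') : Set (Fld d R)) ((W a K).wc k') r ((𝒯.T a K).gen b k'))
variable (hFn : ∀ (a : P) (K : ℕ), ∀ (b : (𝒯.B a K).Birth) (k' k : ℕ), (𝒯.B a K).birthScale b ≤ k' → k' ≤ k →
  k + 1 ≤ (𝒯.B a K).K →
  RanBelow (budgetGate (𝒯.T a K) (s a K) m (S a K) (4 * cδ / r) (fun i => (L ^ 2)⁻¹ * (fun _ : ℕ => alphaCell κ) i)) (k + 1) →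
  ∀ U, (Fn a K) b k' (k + 1) U =
    wOp (expWeight ((base a K) b k) ((𝒜 a K) b k + (𝒬 a K) b k)) ((μ a K) b k) ((z₀ a K) b k) U (fun z => (Fn a K) b k' k (U + z)))
variable (h𝒢 : ∀ (a : P) (K : ℕ), ∀ (b : (𝒯.B a K).Birth) (k' k : ℕ), (𝒯.B a K).birthScale b ≤ k' → k' ≤ k →
  k + 1 ≤ (𝒯.B a K).K →
  RanBelow (budgetGate (𝒯.T a K) (s a K) m (S a K) (4 * cδ / r) (fun i => (L ^ 2)⁻¹ * (fun _ : ℕ => alphaCell κ) i)) (k + 1) →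
  ∀ U, (fun z => (Fn a K) b k' k (U + z)) ∈ BddClass ℂ ((μ a K) b k))
variable (hB : ∀ (a : P) (K : ℕ), ∀ (b : (𝒯.B a K).Birth) (k' k : ℕ), (𝒯.B a K).birthScale b ≤ k' → k' ≤ k →
  k + 1 ≤ (𝒯.B a K).K →
  RanBelow (budgetGate (𝒯.T a K) (s a K) m (S a K) (4 * cδ / r) (fun i => (L ^ 2)⁻¹ * (fun _ : ℕ => alphaCell κ) i)) (k + 1) →
  RealBaseAt ((ref a K) b k) ((base a K) b k) ((𝒜 a K) b k) ((μ a K) b k) (bondBall d ((W a K).ρw (k + 1)) : Set (Fld d R)))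
variable (hE : ∀ (a : P) (K : ℕ), ∀ (b : (𝒯.B a K).Birth) (k' k : ℕ), (𝒯.B a K).birthScale b ≤ k' → k' ≤ k →
  k + 1 ≤ (𝒯.B a K).K →
  RanBelow (budgetGate (𝒯.T a K) (s a K) m (S a K) (4 * cδ / r) (fun i => (L ^ 2)⁻¹ * (fun _ : ℕ => alphaCell κ) i)) (k + 1) →
  ExponentSliceAt ((ref a K) b k) ((𝒜 a K) b k) ((μ a K) b k) latMove latN (bondBall d ((W a K).ρw (k + 1)) : Set (Fld d R))
    ((W a K).wc (k + 1)) ((W a K).ϱc k) ((s a K) b k))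
variable (hδf : ∀ (a : P) (K : ℕ), ∀ b k, ∀ x ∈ (Sg a K) k b, 0 ≤ (δf a K) b k x ∧ (δf a K) b k x ≤ cδ * ((L ^ 2)⁻¹) ^ (k - x.2))
variable (hDμ : ∀ (a : P) (K : ℕ), ∀ b k, ∀ᵐ z ∂(μ a K) b k, z ∈ (bondBall d ((W a K).σ k) : Set (Fld d R)))
variable (hz₁ : ∀ (a : P) (K : ℕ), ∀ b k, (z₁ a K) b k ∈ (bondBall d ((W a K).σ k) : Set (Fld d R)))
variable (hpairx : ∀ (a : P) (K : ℕ), ∀ (b : (𝒯.B a K).Birth) (k' k : ℕ), (𝒯.B a K).birthScale b ≤ k' → k' ≤ k →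
  ∀ x ∈ (Sg a K) k b, ∀ U₀ ∈ (bondBall d ((W a K).ρw (k + 1)) : Set (Fld d R)), ∀ pd : NDir d R, 0 < latN pd →
    latN pd ≤ (W a K).wc (k + 1) →
    ∀ᵐ z ∂(μ a K) b k, ∀ t ∈ tube ((W a K).ϱ₁ k / latN pd),
      RelGauge ((rel a K) x.1 x.2 k) latMove latN (latMove U₀ pd t + (z₁ a K) b k) (latMove U₀ pd t + z) ((δf a K) b k x))
variable (hinv : ∀ (a : P) (K : ℕ), ∀ b k' k, GaugeInvariant ((rel a K) b k' k) ((Fn a K) b k' k))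
variable (hmeas : ∀ (a : P) (K : ℕ), ∀ (b f : (𝒯.B a K).Birth) (k'' k : ℕ) (U : Fld d R),
  AEStronglyMeasurable (fun z => (Fn a K) f k'' k (U + z)) ((μ a K) b k))
variable (hdefwk : ∀ (a : P) (K : ℕ), ∀ (b : (𝒯.B a K).Birth) (k' k : ℕ), (defect a K) b k' k ≤ (W a K).wc k)
variable (hrate : ∀ (a : P) (K : ℕ), ∀ (b : (𝒯.B a K).Birth) (k' k : ℕ), (𝒯.B a K).birthScale b ≤ k' → k' ≤ k → k ≤ (𝒯.B a K).K →
  (defect a K) b k' k ≤ cδ * ((L ^ 2)⁻¹) ^ (k - k'))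
-- F-8 REPLACED BY THE BOOKING CONVENTION (row S8): admissible pairs exist, booked size ≤ sup of realised increments
variable (hne : ∀ (a : P) (K : ℕ), ∀ (b : (𝒯.B a K).Birth) (k' k : ℕ), (𝒯.B a K).birthScale b ≤ k' → k' ≤ k → k ≤ (𝒯.B a K).K →
  RanBelow (budgetGate (𝒯.T a K) (s a K) m (S a K) (4 * cδ / r) (fun i => (L ^ 2)⁻¹ * (fun _ : ℕ => alphaCell κ) i)) k →
  ∃ U₀ ∈ (bondBall d ((W a K).ρw k) : Set (Fld d R)), ∃ U₁ : Fld d R,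
  RelGauge ((rel a K) b k' k) latMove latN U₀ U₁ ((defect a K) b k' k))
variable (hsup : ∀ (a : P) (K : ℕ), ∀ (b : (𝒯.B a K).Birth) (k' k : ℕ), (𝒯.B a K).birthScale b ≤ k' → k' ≤ k → k ≤ (𝒯.B a K).K →
  RanBelow (budgetGate (𝒯.T a K) (s a K) m (S a K) (4 * cδ / r) (fun i => (L ^ 2)⁻¹ * (fun _ : ℕ => alphaCell κ) i)) k →
  (𝒯.T a K).lin b k' k ≤ sSup {x : ℝ | ∃ U₀ ∈ (bondBall d ((W a K).ρw k) : Set (Fld d R)), ∃ U₁ : Fld d R,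
    RelGauge ((rel a K) b k' k) latMove latN U₀ U₁ ((defect a K) b k' k) ∧ x = ‖(Fn a K) b k' k U₁ - (Fn a K) b k' k U₀‖})
-- the booking-level wall binders: (w5) regeneration, (w2-act) margin
variable (hc0 : ∀ (a : P) (K : ℕ), ∀ k, 0 ≤ (creg a K) k)
variable (hcb : ∀ (a : P) (K : ℕ), ∀ k, k < (𝒯.B a K).K → (creg a K) k ≤ cbar)
variable (hreg : ∀ (a : P) (K : ℕ), (𝒯.T a K).RegeneratesFromVar (creg a K)
  (budgetGate (𝒯.T a K) (s a K) m (S a K) (4 * cδ / r) (fun _ : ℕ => (L ^ 2)⁻¹ * alphaCell κ)))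
variable (hs₀ : ∀ (a : P) (K : ℕ), ∀ b k, (s a K) b k ≤ sbar)
-- (w3-book) L-C REPLACED BY ANCHORING DATA (row S4): blocking integer, multiplicity, housing, component volume
variable (hLb : (Lb : ℝ) = L)
variable (hmult : ∀ (a : P) (K : ℕ), ∀ j (x : Fin 4 → ℕ),
  ((𝒯.B a K).births.filter fun b => (𝒯.B a K).birthScale b = j ∧ x ∈ (Anch a K).dom b).card ≤ mB)
variable (hscale : ∀ (a : P) (K : ℕ), ∀ k b, ∀ q ∈ (comp a K) k b, (𝒯.B a K).cubeScale q = k)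
variable (hhoused : ∀ (a : P) (K : ℕ), ∀ k b, ∀ f ∈ (S a K) k b, ∃ q ∈ (comp a K) k b, f ∈ (𝒯.B a K).feltAt q)
variable (hvol : ∀ (a : P) (K : ℕ), ∀ k b, ((comp a K) k b).card ≤ v)
-- (w1)+(w5b) L-B REPLACED BY ABSORPTION DATA (rows S5 ∕ S5b)
variable (holder : ∀ (a : P) (K : ℕ), ∀ b b₀, b₀ ∈ (Sabs a K) b → (𝒯.B a K).birthScale b₀ < (𝒯.B a K).birthScale b)
variable (hsub : ∀ (a : P) (K : ℕ), ∀ b, (Sabs a K) b ⊆ (S a K) ((𝒯.B a K).birthScale b) b)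
variable (habs : ∀ (a : P) (K : ℕ), (𝒯.T a K).AbsorbsFrom (4 * cδ / r) (fun _ : ℕ => (L ^ 2)⁻¹ * alphaCell κ) (β a K) A (Sabs a K)
  (budgetGate (𝒯.T a K) (s a K) m (S a K) (4 * cδ / r) (fun _ : ℕ => (L ^ 2)⁻¹ * alphaCell κ)))
variable (hβ : ∀ (a : P) (K : ℕ), ∀ j, j ≤ (𝒯.B a K).K → (β a K) j ≤ β₀ * (L⁻¹ ^ 3) ^ ((𝒯.B a K).K - j))

include W hκ Anch hratio hL hcbar hN₀ hA₀ hm hloc hρ'1 hsmall hr hcδ hsl hFn h𝒢 hB hE hδf hDμ hz₁ hpairx hinv hmeas hdefwk hrate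
  hne hsup hc0 hcb hreg hs₀ hLb hmult hscale hhoused hvol holder hsub habs hβ

/-- **THE CANONICAL TERMINAL FACE ⟹ THE ROOT OF RECORD `DressedStabilityStrict 𝒯 (L ^ 4)`** [bookkeeping]: leaf-09's
`dressedStabilityWith_of_canonicalSliceWinSchedules` (S3l, THE CANONICAL TERMINAL FACE — constants
`(A₀, rhoOne (L^2)⁻¹ (4c_δ∕r) c̄ κ, L⁻¹^3)` displayed) BY NAME, fed to the owner's root of record through §1: the strict product of the
displayed constants against the positional count constant `Λ = L⁴` IS (w7)'s located largeness `hloc`, strict by `hρ′1`.  SAME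
displayed list as S3l (the WALL∕Q binders ∀ (a,K), the H2 dictionary `hQ`∕`hSg`, `hcm`∕`hδfwk`, anchoring ∕ absorption ∕
booking-convention DATA, located scalars ONCE before `∀ a K`); nothing added, nothing removed.  NOT «NE1′ proved»: every wall binder
displayed; 0 instantiated on Bałaban's densities. [folklore] -/
theorem dressedStabilityStrict_of_canonicalSliceWinSchedules
    -- the H2 dictionary the canonical data are built from
    (hQ : ∀ (a : P) (K : ℕ), ∀ b k, (fun U z => (𝒬 a K) b k U z - (q a K) b k U) =
      fun U z => (c a K) b k * ∑ x ∈ (Sg a K) k b, ((Fn a K) x.1 x.2 k (U + z) - (Fn a K) x.1 x.2 k (U + (z₁ a K) b k)))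
    (hSg : ∀ (a : P) (K : ℕ), ∀ k b, ∀ x ∈ (Sg a K) k b, x.1 ∈ (S a K) k b ∧ (𝒯.B a K).birthScale x.1 ≤ x.2 ∧ x.2 ≤ k)
    -- the two binders PARTICULAR to the assembled slice-window face (cutoff-free source tie, per-step slice guard)
    (hcm : ∀ (a : P) (K : ℕ), ∀ b k, ‖(c a K) b k‖ ≤ m)
    (hδfwk : ∀ (a : P) (K : ℕ), ∀ b k, ∀ x ∈ (Sg a K) k b, (δf a K) b k x ≤ (W a K).wc k)
    (hvN₀ : (v : ℝ) * mB ≤ N₀) (hA : 0 ≤ A)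
    (hfan : fanout A N₀ ρ' < 1) (hamp : absorbAmplitude β₀ A N₀ ρ' ≤ A₀) :
    DressedStabilityStrict 𝒯 (L ^ 4) :=
  dressedStabilityStrict_of_cellWith hL hloc hρ'1
    (dressedStabilityWith_of_canonicalSliceWinSchedules 𝒯 W hκ Anch hratio hL hcbar hN₀ hA₀ hm hloc hρ'1 hsmall hr hcδ hsl hFn
      h𝒢 hB hE hδf hDμ hz₁ hpairx hinv hmeas hdefwk hrate hne hsup hc0 hcb hreg hs₀ hLb hmult hscale hhoused hvol holder hsub habs
      hβ hQ hSg hcm hδfwk hvN₀ hA hfan hamp)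

/-- The product-free headline at the canonical terminal face is RECOVERED from the root of record (consistency with S3l's
`dressedStability_of_canonicalSliceWinSchedules`: same statement, reached through `DressedStabilityStrict`). [folklore] -/
example
    (hQ : ∀ (a : P) (K : ℕ), ∀ b k, (fun U z => (𝒬 a K) b k U z - (q a K) b k U) =
      fun U z => (c a K) b k * ∑ x ∈ (Sg a K) k b, ((Fn a K) x.1 x.2 k (U + z) - (Fn a K) x.1 x.2 k (U + (z₁ a K) b k)))
    (hSg : ∀ (a : P) (K : ℕ), ∀ k b, ∀ x ∈ (Sg a K) k b, x.1 ∈ (S a K) k b ∧ (𝒯.B a K).birthScale x.1 ≤ x.2 ∧ x.2 ≤ k)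
    (hcm : ∀ (a : P) (K : ℕ), ∀ b k, ‖(c a K) b k‖ ≤ m)
    (hδfwk : ∀ (a : P) (K : ℕ), ∀ b k, ∀ x ∈ (Sg a K) k b, (δf a K) b k x ≤ (W a K).wc k)
    (hvN₀ : (v : ℝ) * mB ≤ N₀) (hA : 0 ≤ A)
    (hfan : fanout A N₀ ρ' < 1) (hamp : absorbAmplitude β₀ A N₀ ρ' ≤ A₀) :
    DressedStability 𝒯 :=
  dressedStability_of_strict
    (dressedStabilityStrict_of_canonicalSliceWinSchedules 𝒯 W hκ Anch hratio hL hcbar hN₀ hA₀ hm hloc hρ'1 hsmall hr hcδ hsl hFn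
      h𝒢 hB hE hδf hDμ hz₁ hpairx hinv hmeas hdefwk hrate hne hsup hc0 hcb hreg hs₀ hLb hmult hscale hhoused hvol holder hsub habs
      hβ hQ hSg hcm hδfwk hvN₀ hA hfan hamp)

end EndAll

end Summit.QuantumFields.BalabanUV.T4Continuum.NE1p.DressedStabilityStrictOfCanonicalSliceWinSchedules

end
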